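import Mathlib

/-!
# Sub-solution comparison for nonnegative matrices with a Collatz–Wielandt witness (solo-blind s81, §24.91 (T-b))

The within-step closure of the J-tail certificate bounds the suprema `φ_m` over one time step of the
head-mode amplitudes by `φ ≤ g + B φ` with a nonnegative tridiagonal `B` (coupling sups × step ×
one-step growth).  If `B` admits a positive vector `v` with `B v < v` componentwise (so `ρ(B) < 1`),
then any `w` with `g + B w ≤ w` dominates `φ`.  The proof is the maximum principle on `(φ - w)/v`;
no inverse, no spectral theory.  Together with a ball-arithmetic upper bound `Λ ≥ (1 - B)⁻¹`
(for which `w = Λ g` is a supersolution) this is lemma (T-b) of §24.91.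

* `mmatrix_comparison` — `B ≥ 0`, `v > 0`, `B v < v`, `x ≤ a + B x`, `a + B w ≤ w` imply `x ≤ w`.
-/

namespace Summit.AnomalousDissipation.AnomalousDissipation.Theorems

open Finset

/-- **Comparison for sub-solutions of `x ≤ a + Bx`** with `B ≥ 0` sub-stochastic in the weighted
sense `Bv < v` for some `v > 0`: every supersolution `w` (`a + Bw ≤ w`) dominates `x`. -/
theorem mmatrix_comparison {n : ℕ} (B : Fin n → Fin n → ℝ) (x a w v : Fin n → ℝ)
    (hB : ∀ i j, 0 ≤ B i j) (hv : ∀ i, 0 < v i) (hBv : ∀ i, ∑ j, B i j * v j < v i)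
    (hx : ∀ i, x i ≤ a i + ∑ j, B i j * x j) (hw : ∀ i, a i + ∑ j, B i j * w j ≤ w i) :
    ∀ i, x i ≤ w i := by
  intro i₁
  have hne : (univ : Finset (Fin n)).Nonempty := ⟨i₁, mem_univ _⟩
  obtain ⟨i₀, -, hmax⟩ := exists_max_image univ (fun i => (x i - w i) / v i) hne
  set c := (x i₀ - w i₀) / v i₀ with hc
  -- every component is bounded by c * v
  have hle : ∀ j, x j - w j ≤ c * v j := by
    intro j
    have := hmax j (mem_univ j)
    rw [div_le_iff₀ (hv j)] at this
    -- this : x j - w j ≤ (x i₀ - w i₀) / v i₀ * v j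
    simpa [hc] using this
  by_cases hcpos : c ≤ 0
  · have := hle i₁
    have : x i₁ - w i₁ ≤ 0 := this.trans (mul_nonpos_of_nonpos_of_nonneg hcpos (hv i₁).le)
    linarith
  · push Not at hcpos
    -- at i₀: x - w ≤ B (x - w) ≤ c B v < c v = x i₀ - w i₀, contradiction
    have h1 : x i₀ - w i₀ ≤ ∑ j, B i₀ j * (x j - w j) := by
      have e : ∑ j, B i₀ j * (x j - w j) = ∑ j, B i₀ j * x j - ∑ j, B i₀ j * w j := by
        rw [← sum_sub_distrib]; refine sum_congr rfl fun j _ => by ring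
      rw [e]; linarith [hx i₀, hw i₀]
    have h2 : ∑ j, B i₀ j * (x j - w j) ≤ ∑ j, B i₀ j * (c * v j) :=
      sum_le_sum fun j _ => mul_le_mul_of_nonneg_left (hle j) (hB i₀ j)
    have h3 : ∑ j, B i₀ j * (c * v j) = c * ∑ j, B i₀ j * v j := by
      rw [mul_sum]; refine sum_congr rfl fun j _ => by ring
    have h4 : c * ∑ j, B i₀ j * v j < c * v i₀ := mul_lt_mul_of_pos_left (hBv i₀) hcpos
    have h5 : x i₀ - w i₀ = c * v i₀ := by
      rw [hc, div_mul_cancel₀ _ (hv i₀).ne']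
    linarith
end Summit.AnomalousDissipation.AnomalousDissipation.Theorems
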